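import Literature.AlgebraicGeometry.HodgeTheory.ComplexConjugation
import Mathlib.LinearAlgebra.Matrix.ToLin
import HarnessLib

/-!
# Crux `WeilTwelvefoldsSqrtMinus7` (stmt-HodgeConjecture-1261), line `amnesic-secant-sheaves-split-fourteenfolds` — lemmas for stub `stub_weilSignatureOfModel` (α₂, r6), part II: coordinates and conjugation

Helper file of the stub `stub_weilSignatureOfModel` (signature `(n, n)` of the rational degree-one model of a
polarized abelian variety of Weil type; B. van Geemen, LNM 1594 (1994), Lemma 5.2 (4)–(5)): the dictionary
between the classes of `H¹(A(ℂ); ℂ)` and their coordinate vectors in a rational basis `b` (the rational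
degree-one model `(u, M_A, ω, G_A)` of `(A, φ, h)` reads `φ^* bᵢ = Σⱼ M_A j i • bⱼ`,
`Q_h(bᵢ, bⱼ) = G_A i j • ω`):

* `weilSig_equivFun_map` — an endomorphism `T` with `T bᵢ = Σⱼ M_A j i • bⱼ` acts on coordinates by `M_A`;
* `weilSig_pairing_eq` — a bilinear `Q` with `Q(bᵢ, bⱼ) = G_A i j • ω` is `(x ⬝ G_A y) • ω` in coordinates;
* `weilSig_matrix_sq` — `T² = -d` forces `M_A² = -d`;
* `weilSig_conjClass_sum`, `weilSig_equivFun_conjClass` — complex conjugation `conjClass` of `Hᵏ(Y; ℂ)`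
  (`Literature/AlgebraicGeometry/HodgeTheory/ComplexConjugation`) is coordinatewise conjugation in a basis of
  RATIONAL classes (rational classes are real, `IsRationalClass.conjClass_eq`; Voisin I, Cor. 6.12).

Everything is proved; no definition and no named fact is introduced.
-/

noncomputable section

set_option linter.dupNamespace false

open scoped Matrix
open Literature.AlgebraicGeometry.HodgeTheory Literature.AlgebraicTopology.SingularHomology

universe u

namespace Summit.HodgeConjecture.HodgeConjecture.Theorems.WeilTwelvefoldsSqrtMinus7.AmnesicSecantSheaves

/-- Expanding a bilinear map on two finite combinations of a family (private copy of the part-I lemma,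
kept here so that the helper files are independent). [folklore] -/
private theorem bilin_sum_sum' {R V W κ : Type*} [CommSemiring R] [AddCommMonoid V] [Module R V]
    [AddCommMonoid W] [Module R W] [Fintype κ] (B : V →ₗ[R] V →ₗ[R] W) (a c : κ → R) (u : κ → V) :
    B (∑ i, a i • u i) (∑ j, c j • u j) = ∑ i, ∑ j, (a i * c j) • B (u i) (u j) := by
  have h1 : ∀ j, B (∑ i, a i • u i) (c j • u j) = ∑ i, (a i * c j) • B (u i) (u j) := by
    intro j
    rw [LinearMap.map_smul, map_sum, LinearMap.sum_apply, Finset.smul_sum]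
    refine Finset.sum_congr rfl fun i _ => ?_
    rw [LinearMap.map_smul, LinearMap.smul_apply, smul_smul, mul_comm]
  rw [map_sum]
  simp_rw [h1]
  rw [Finset.sum_comm]

/-! ## Coordinates in a basis with rational structure constants -/

section Coordinates

variable {ι : Type*} [Fintype ι] {V W : Type*} [AddCommGroup V] [Module ℂ V] [AddCommGroup W] [Module ℂ W]
  (b : Module.Basis ι ℂ V)

/-- **An endomorphism with matrix `M_A` in the basis acts on coordinates by `M_A`**: if
`T bᵢ = Σⱼ M_A j i • bⱼ` then `b.equivFun (T x) = M_A · b.equivFun x`. [folklore] -/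
theorem weilSig_equivFun_map [DecidableEq ι] {T : V →ₗ[ℂ] V} {MA : Matrix ι ι ℚ}
    (hT : ∀ i, T (b i) = ∑ j, ((MA j i : ℚ) : ℂ) • b j) (x : V) :
    b.equivFun (T x) = (MA.map (algebraMap ℚ ℂ)).mulVec (b.equivFun x) := by
  conv_lhs => rw [← b.sum_equivFun x]
  rw [map_sum]
  simp_rw [map_smul, hT, Finset.smul_sum, smul_smul]
  rw [Finset.sum_comm]
  have e : ∀ j, ∑ i, (b.equivFun x i * ((MA j i : ℚ) : ℂ)) • b j =
      (∑ i, ((MA j i : ℚ) : ℂ) * b.equivFun x i) • b j := fun j => by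
    rw [← Finset.sum_smul]
    simp_rw [mul_comm]
  simp_rw [e]
  rw [map_sum]
  simp_rw [map_smul]
  funext k
  simp only [Finset.sum_apply, Pi.smul_apply, Module.Basis.equivFun_self, smul_eq_mul, mul_ite, mul_one,
    mul_zero, Finset.sum_ite_eq', Finset.mem_univ, if_true]
  rfl

/-- **A bilinear map with Gram matrix `G_A • ω` in the basis is `(x ⬝ G_A y) • ω` in coordinates.**
[folklore] -/
theorem weilSig_pairing_eq {Q : V →ₗ[ℂ] V →ₗ[ℂ] W} {GA : Matrix ι ι ℚ} {ω : W}
    (hQ : ∀ i j, Q (b i) (b j) = ((GA i j : ℚ) : ℂ) • ω) (x y : V) :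
    Q x y = (b.equivFun x ⬝ᵥ (GA.map (algebraMap ℚ ℂ)).mulVec (b.equivFun y)) • ω := by
  conv_lhs => rw [← b.sum_equivFun x, ← b.sum_equivFun y]
  rw [bilin_sum_sum']
  simp_rw [hQ, smul_smul, ← Finset.sum_smul]
  congr 1
  simp only [dotProduct, Matrix.mulVec, Matrix.map_apply, Finset.mul_sum]
  refine Finset.sum_congr rfl fun i _ => Finset.sum_congr rfl fun j _ => ?_
  change _ = _ * ((GA i j : ℂ) * _)
  ring

/-- **`T² = -d` forces `M_A² = -d`** for the rational matrix `M_A` of `T` in the basis (`ℚ ↪ ℂ` and two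
matrices with the same action on `ℂ^ι` are equal). [folklore] -/
theorem weilSig_matrix_sq [DecidableEq ι] {T : V →ₗ[ℂ] V} {MA : Matrix ι ι ℚ}
    (hT : ∀ i, T (b i) = ∑ j, ((MA j i : ℚ) : ℂ) • b j) {d : ℚ}
    (hTT : ∀ x, T (T x) = -(((d : ℚ) : ℂ) • x)) : MA * MA = (-d) • (1 : Matrix ι ι ℚ) := by
  have hv : ∀ v : ι → ℂ, (MA * MA).map (algebraMap ℚ ℂ) *ᵥ v = ((-d) • (1 : Matrix ι ι ℚ)).map (algebraMap ℚ ℂ) *ᵥ v := by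
    intro v
    set x := b.equivFun.symm v with hx
    have hxv : b.equivFun x = v := LinearEquiv.apply_symm_apply _ v
    have h1 : b.equivFun (T (T x)) = (MA * MA).map (algebraMap ℚ ℂ) *ᵥ v := by
      rw [weilSig_equivFun_map b hT (T x), weilSig_equivFun_map b hT x, hxv, Matrix.mulVec_mulVec,
        ← Matrix.map_mul]
    have h2 : b.equivFun (T (T x)) = -(((d : ℚ) : ℂ) • v) := by
      rw [hTT, map_neg, map_smul, hxv]
    have e : ((-d) • (1 : Matrix ι ι ℚ)).map (algebraMap ℚ ℂ) = (-((d : ℚ) : ℂ)) • (1 : Matrix ι ι ℂ) := by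
      ext i j
      by_cases hij : i = j <;> simp [hij]
    rw [← h1, h2, e, Matrix.smul_mulVec, Matrix.one_mulVec, neg_smul]
  have hm : (MA * MA).map (algebraMap ℚ ℂ) = ((-d) • (1 : Matrix ι ι ℚ)).map (algebraMap ℚ ℂ) :=
    Matrix.toLin'.injective (LinearMap.ext fun v => by rw [Matrix.toLin'_apply, Matrix.toLin'_apply, hv])
  exact Matrix.map_injective (algebraMap ℚ ℂ).injective hm

end Coordinates

/-! ## Conjugation in a rational basis -/

section Conjugation

/-- Conjugation of a finite sum of classes. [folklore] -/
theorem weilSig_conjClass_sum {Y : Type u} [TopologicalSpace Y] {k : ℕ} {κ : Type*} (s : Finset κ)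
    (f : κ → singularCohomology ℂ ℂ Y k) :
    conjClass Y k (∑ i ∈ s, f i) = ∑ i ∈ s, conjClass Y k (f i) :=
  map_sum (conjClassEquiv Y k) f s

/-- **In a basis of rational (hence real, `IsRationalClass.conjClass_eq`) classes, conjugation of
`Hᵏ(Y; ℂ)` is coordinatewise complex conjugation.** [cite: VoisinHodgeI2002, Cor. 6.12] -/
theorem weilSig_equivFun_conjClass {Y : Type*} [TopologicalSpace Y] {k : ℕ} {ι : Type*} [Fintype ι]
    (b : Module.Basis ι ℂ (singularCohomology ℂ ℂ Y k)) (hb : ∀ i, IsRationalClass (b i))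
    (x : singularCohomology ℂ ℂ Y k) : b.equivFun (conjClass Y k x) = star (b.equivFun x) := by
  conv_lhs => rw [← b.sum_equivFun x]
  rw [weilSig_conjClass_sum]
  simp_rw [conjClass_smul, (hb _).conjClass_eq]
  funext j
  rw [Module.Basis.equivFun_apply, Module.Basis.repr_sum_self]
  rfl

end Conjugation

end Summit.HodgeConjecture.HodgeConjecture.Theorems.WeilTwelvefoldsSqrtMinus7.AmnesicSecantSheaves

end
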